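import Literature.Analysis.OperatorTheory.GaussianTransferKernel
import HarnessLib

/-!
# The harmonic transfer kernel against a GENERAL Gaussian weight: `∫ K(x,y) e^{−c'‖y‖²} dy = (π/s')^{n/2} e^{−(c' + κ)‖x‖²}`,
# `s' = a + b + c'`, `κ = (a² + 2ab − c'²)/s'` — a FATTER-than-ground-state Gaussian (`c' < c = √(a²+2ab)`) is a super-solution with a
# Gaussian GAIN `e^{−κ‖x‖²}`, `κ > 0`

Source: A. Wipf, *Statistical Approach to Quantum Field Theory* (LNP 992, Springer 2021), §8.5.1 (8.54)–(8.58) — the harmonic transfer kernel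
`K(x,y) = e^{−a‖x‖²}e^{−b‖x−y‖²}e^{−a‖y‖²}` and its Gaussian ground state `e^{−c‖x‖²}`, `c² = a² + 2ab` (tree `GaussianTransferKernel`,
`integral_gaussKernel_mul_groundState`).  This file records the same Gaussian integral for an ARBITRARY weight exponent `c' ≥ 0` (completing the square
without the Riccati condition):

* `complete_square_gen` — `a‖x‖² + b‖x−y‖² + (a+c')‖y‖² = s'‖y − (b/s')x‖² + (c' + κ)‖x‖²`, `κ = (a² + 2ab − c'²)/s'`;
* ★ `integral_gaussKernel_mul_gaussian` — `∫ K(x,y) e^{−c'‖y‖²} dy = (π/s')^{n/2} · e^{−κ‖x‖²} · e^{−c'‖x‖²}`; `gainRate_nonneg` / `gainRate_pos`: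
  `κ ≥ 0` iff `c'² ≤ a² + 2ab`, `κ > 0` if `c'² < a² + 2ab` — the weighted Schur test (Grafakos App. A.2) with the weight `e^{−c'‖·‖²}` on a region
  `{‖x‖ ≥ r}` therefore gains `e^{−κr²}` over the prefactor `(π/s')^{n/2}` (which exceeds the top eigenvalue `(π/s)^{n/2}` only by the fixed factor
  `(s/s')^{n/2}`);
* the real-line and the anisotropic product (`ι → ℝ`, exponents `aᵢ, c'ᵢ`) versions `…_real`, `…_pi`.

Use (cell `ym-fleet`, crux `TwistedTraceScaling` stmt-QuantumFields-20203, S-BASE VALLEY, design note `pub/ym-fleet/ym-luscher-20007-p1/COARSE-DESIGN.md`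
§12 addendum): the valley Schur weight is the background-adapted stiff Gaussian FATTENED by `(1−ε)`; points with a stiff excursion gain `e^{−κ‖x‖²}`,
`κ ≍ εc`, points with a twist far from the torons gain by toron minimality (`Summit…TwoLattice.Toron`).

## References
* A. Wipf, *Statistical Approach to Quantum Field Theory*, LNP 992, Springer 2021, §8.5.1 (8.54)–(8.58). [Wipf2021]
* L. Grafakos, *Modern Fourier Analysis*, GTM 250, Springer 2009, App. A.2. [Grafakos2009]
-/

noncomputable section

open MeasureTheory Real
open scoped RealInnerProductSpace

namespace Literature.Analysis.OperatorTheory.GaussianTransferKernel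

variable {V : Type*} [NormedAddCommGroup V] [InnerProductSpace ℝ V] [FiniteDimensional ℝ V]
  [MeasurableSpace V] [BorelSpace V]

/-! ## §1 Completing the square with a general weight exponent -/

/-- The Gaussian GAIN RATE of the weight `e^{−c'‖x‖²}` under the harmonic kernel: `κ(a,b,c') = (a² + 2ab − c'²)/(a + b + c')`.
(An abbreviation-free statement is used throughout; this docstring names the quantity.) [cite: Wipf2021, §8.5.1 (8.56)–(8.57)] -/
theorem gainRate_eq {a b c' : ℝ} (hs : a + b + c' ≠ 0) :
    a + b - b ^ 2 / (a + b + c') = c' + (a ^ 2 + 2 * a * b - c' ^ 2) / (a + b + c') := by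
  field_simp
  ring

omit [FiniteDimensional ℝ V] [MeasurableSpace V] [BorelSpace V] in
/-- Completing the square WITHOUT the Riccati condition: for `s' = a + b + c' ≠ 0`,
`a‖x‖² + b‖x−y‖² + (a + c')‖y‖² = s'‖y − (b/s')x‖² + (c' + (a² + 2ab − c'²)/s')‖x‖²`. [cite: Wipf2021, §8.5.1 (8.56)–(8.57)] -/
theorem complete_square_gen {a b c' : ℝ} (hs : a + b + c' ≠ 0) (x y : V) :
    a * ‖x‖ ^ 2 + b * ‖x - y‖ ^ 2 + (a + c') * ‖y‖ ^ 2 =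
      (a + b + c') * ‖y - (b / (a + b + c')) • x‖ ^ 2 + (c' + (a ^ 2 + 2 * a * b - c' ^ 2) / (a + b + c')) * ‖x‖ ^ 2 := by
  have h1 : ‖x - y‖ ^ 2 = ‖x‖ ^ 2 - 2 * ⟪x, y⟫ + ‖y‖ ^ 2 := norm_sub_sq_real x y
  have h2 : ‖y - (b / (a + b + c')) • x‖ ^ 2 =
      ‖y‖ ^ 2 - 2 * ((b / (a + b + c')) * ⟪x, y⟫) + (b / (a + b + c')) ^ 2 * ‖x‖ ^ 2 := by
    rw [norm_sub_sq_real, inner_smul_right, real_inner_comm x y, norm_smul, mul_pow, Real.norm_eq_abs, sq_abs]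
  rw [h1, h2, ← gainRate_eq hs]
  field_simp
  ring

/-! ## §2 The kernel against a general Gaussian weight -/

omit [FiniteDimensional ℝ V] [MeasurableSpace V] [BorelSpace V] in
/-- Pointwise: `K(x,y) e^{−c'‖y‖²} = e^{−(c'+κ)‖x‖²} · e^{−s'‖y − (b/s')x‖²}`. [cite: Wipf2021, §8.5.1 (8.56)] -/
theorem gaussKernel_mul_gaussian_eq {a b c' : ℝ} (hs : a + b + c' ≠ 0) (x y : V) :
    Real.exp (-(a * ‖x‖ ^ 2)) * Real.exp (-(b * ‖x - y‖ ^ 2)) * Real.exp (-(a * ‖y‖ ^ 2)) * Real.exp (-(c' * ‖y‖ ^ 2)) =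
      Real.exp (-((c' + (a ^ 2 + 2 * a * b - c' ^ 2) / (a + b + c')) * ‖x‖ ^ 2)) *
        Real.exp (-((a + b + c') * ‖y - (b / (a + b + c')) • x‖ ^ 2)) := by
  rw [← Real.exp_add, ← Real.exp_add, ← Real.exp_add, ← Real.exp_add]
  congr 1
  have h := complete_square_gen (V := V) hs x y
  linarith

/-- ★ **THE HARMONIC KERNEL AGAINST A GENERAL GAUSSIAN WEIGHT**: for `a ≥ 0`, `b > 0`, `c' ≥ 0`, `s' = a + b + c'`,
`∫ e^{−a‖x‖²} e^{−b‖x−y‖²} e^{−a‖y‖²} e^{−c'‖y‖²} dy = (π/s')^{n/2} · e^{−κ‖x‖²} · e^{−c'‖x‖²}`, `κ = (a² + 2ab − c'²)/s'`, `n = finrank V`.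
(At the Riccati value `c'² = a² + 2ab` this is the ground-state identity `integral_gaussKernel_mul_groundState`.) [cite: Wipf2021, §8.5.1 (8.56)–(8.57)] -/
theorem integral_gaussKernel_mul_gaussian {a b c' : ℝ} (ha : 0 ≤ a) (hb : 0 < b) (hc' : 0 ≤ c') (x : V) :
    ∫ y, Real.exp (-(a * ‖x‖ ^ 2)) * Real.exp (-(b * ‖x - y‖ ^ 2)) * Real.exp (-(a * ‖y‖ ^ 2)) * Real.exp (-(c' * ‖y‖ ^ 2)) =
      (π / (a + b + c')) ^ ((Module.finrank ℝ V : ℝ) / 2) *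
        Real.exp (-((a ^ 2 + 2 * a * b - c' ^ 2) / (a + b + c') * ‖x‖ ^ 2)) * Real.exp (-(c' * ‖x‖ ^ 2)) := by
  have hs : 0 < a + b + c' := by linarith
  simp_rw [gaussKernel_mul_gaussian_eq hs.ne']
  rw [integral_const_mul]
  have ht := integral_sub_right_eq_self (μ := (volume : Measure V))
    (fun y : V => Real.exp (-((a + b + c') * ‖y‖ ^ 2))) ((b / (a + b + c')) • x)
  rw [ht]
  have hg := GaussianFourier.integral_rexp_neg_mul_sq_norm (V := V) hs
  simp only [neg_mul] at hg
  rw [hg, mul_comm]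
  conv_rhs => rw [mul_assoc, ← Real.exp_add]
  congr 2
  ring

/-- `κ ≥ 0` for a weight at most as sharp as the ground state: `c'² ≤ a² + 2ab`. [cite: Wipf2021, §8.5.1 (8.57)] -/
theorem gainRate_nonneg {a b c' : ℝ} (ha : 0 ≤ a) (hb : 0 < b) (hc' : 0 ≤ c') (hle : c' ^ 2 ≤ a ^ 2 + 2 * a * b) :
    0 ≤ (a ^ 2 + 2 * a * b - c' ^ 2) / (a + b + c') :=
  div_nonneg (by linarith) (by linarith)

/-- `κ > 0` for a weight STRICTLY FATTER than the ground state: `c'² < a² + 2ab`. [cite: Wipf2021, §8.5.1 (8.57)] -/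
theorem gainRate_pos {a b c' : ℝ} (ha : 0 ≤ a) (hb : 0 < b) (hc' : 0 ≤ c') (hlt : c' ^ 2 < a ^ 2 + 2 * a * b) :
    0 < (a ^ 2 + 2 * a * b - c' ^ 2) / (a + b + c') :=
  div_pos (by linarith) (by linarith)

/-- ★ **Gaussian super-solution with gain on an exterior region**: for `a ≥ 0`, `b > 0`, `0 ≤ c'`, `c'² ≤ a² + 2ab` and `‖x‖ ≥ r`,
`∫ K(x,y) e^{−c'‖y‖²} dy ≤ (π/s')^{n/2} e^{−κ r²} · e^{−c'‖x‖²}`. [cite: Grafakos2009, App. A.2] -/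
theorem integral_gaussKernel_mul_gaussian_le_of_norm_ge {a b c' r : ℝ} (ha : 0 ≤ a) (hb : 0 < b) (hc' : 0 ≤ c')
    (hle : c' ^ 2 ≤ a ^ 2 + 2 * a * b) {x : V} (hr : 0 ≤ r) (hx : r ≤ ‖x‖) :
    ∫ y, Real.exp (-(a * ‖x‖ ^ 2)) * Real.exp (-(b * ‖x - y‖ ^ 2)) * Real.exp (-(a * ‖y‖ ^ 2)) * Real.exp (-(c' * ‖y‖ ^ 2)) ≤
      (π / (a + b + c')) ^ ((Module.finrank ℝ V : ℝ) / 2) *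
        Real.exp (-((a ^ 2 + 2 * a * b - c' ^ 2) / (a + b + c') * r ^ 2)) * Real.exp (-(c' * ‖x‖ ^ 2)) := by
  rw [integral_gaussKernel_mul_gaussian ha hb hc' x]
  have hκ := gainRate_nonneg ha hb hc' hle
  have hs : 0 < a + b + c' := by linarith
  refine mul_le_mul_of_nonneg_right (mul_le_mul_of_nonneg_left ?_ (by positivity)) (Real.exp_pos _).le
  exact Real.exp_le_exp.mpr (by nlinarith [mul_le_mul hx hx hr (norm_nonneg x)])

/-! ## §3 The real line and the anisotropic product -/

/-- The real-line case: `∫ e^{−ax²} e^{−b(x−y)²} e^{−ay²} e^{−c'y²} dy = √(π/s')·e^{−κx²}·e^{−c'x²}`. [cite: Wipf2021, §8.5.1 (8.56)–(8.57)] -/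
theorem integral_gaussKernel_mul_gaussian_real {a b c' : ℝ} (ha : 0 ≤ a) (hb : 0 < b) (hc' : 0 ≤ c') (x : ℝ) :
    ∫ y, Real.exp (-(a * x ^ 2)) * Real.exp (-(b * (x - y) ^ 2)) * Real.exp (-(a * y ^ 2)) * Real.exp (-(c' * y ^ 2)) =
      Real.sqrt (π / (a + b + c')) * Real.exp (-((a ^ 2 + 2 * a * b - c' ^ 2) / (a + b + c') * x ^ 2)) * Real.exp (-(c' * x ^ 2)) := by
  have h := integral_gaussKernel_mul_gaussian (V := ℝ) ha hb hc' x
  simp only [Real.norm_eq_abs, sq_abs, Module.finrank_self, Nat.cast_one] at h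
  rw [show Real.sqrt (π / (a + b + c')) = (π / (a + b + c')) ^ ((1 : ℝ) / 2) from Real.sqrt_eq_rpow _]
  exact h

section Pi

variable {ι : Type*} [Fintype ι]

/-- ★ **Anisotropic product version** on `ι → ℝ`: for `aᵢ ≥ 0`, `b > 0`, `c'ᵢ ≥ 0`,
`∫ e^{−Σaᵢxᵢ²} e^{−bΣ(xᵢ−yᵢ)²} e^{−Σaᵢyᵢ²} e^{−Σc'ᵢyᵢ²} dy = (Πᵢ √(π/s'ᵢ)) · e^{−Σ κᵢ xᵢ²} · e^{−Σ c'ᵢ xᵢ²}`, `s'ᵢ = aᵢ + b + c'ᵢ`,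
`κᵢ = (aᵢ² + 2aᵢb − c'ᵢ²)/s'ᵢ`. [cite: Wipf2021, §8.5.2 (8.64)–(8.67)] -/
theorem integral_gaussKernel_mul_gaussian_pi {a c' : ι → ℝ} {b : ℝ} (ha : ∀ i, 0 ≤ a i) (hb : 0 < b) (hc' : ∀ i, 0 ≤ c' i)
    (x : ι → ℝ) :
    ∫ y : ι → ℝ, Real.exp (-(∑ i, a i * x i ^ 2)) * Real.exp (-(b * ∑ i, (x i - y i) ^ 2)) *
        Real.exp (-(∑ i, a i * y i ^ 2)) * Real.exp (-(∑ i, c' i * y i ^ 2)) =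
      (∏ i, Real.sqrt (π / (a i + b + c' i))) *
        Real.exp (-(∑ i, (a i ^ 2 + 2 * a i * b - c' i ^ 2) / (a i + b + c' i) * x i ^ 2)) * Real.exp (-(∑ i, c' i * x i ^ 2)) := by
  simp_rw [gaussKernel_mul_groundState_pi_eq_prod]
  have h := integral_fintype_prod_volume_eq_prod (𝕜 := ℝ) (E := fun _ : ι => ℝ)
    (fun i (t : ℝ) => Real.exp (-(a i * x i ^ 2)) * Real.exp (-(b * (x i - t) ^ 2)) * Real.exp (-(a i * t ^ 2)) *
      Real.exp (-(c' i * t ^ 2)))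
  rw [h]
  simp_rw [integral_gaussKernel_mul_gaussian_real (ha _) hb (hc' _)]
  rw [Finset.prod_mul_distrib, Finset.prod_mul_distrib, ← Real.exp_sum, ← Real.exp_sum, ← Finset.sum_neg_distrib,
    ← Finset.sum_neg_distrib]

end Pi

end Literature.Analysis.OperatorTheory.GaussianTransferKernel

end
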